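import Summits.KontsevichZagierPeriods.KontsevichZagierPeriods.Theorems.PlanarAreas.Negative.GreenBandsLoadBearing
import Literature.NumberTheory.Transcendental.KZLogCalculus

/-!
# `PlanarAreas` (stmt-KontsevichZagierPeriods-4990), line `green-native-bands`: load-bearing
# hypotheses of the worker sub-stub `stub_bandNewtonLeibniz_subband` (negative lemmas, gen 3)

Refuter unit `drefute-stmt-KontsevichZagierPeriods-4990-g3` on the two sub-goals of the engine
`stub_bandNewtonLeibniz` registered by the lead's worker at 2026-08-16T03:56Z/03:57Z
(`stub_bandNewtonLeibniz_cad`, `stub_bandNewtonLeibniz_subband`; skeleton sha 495091be93cf).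
`stub_bandNewtonLeibniz_subband` — rule (3) down ONE closed sub-band `KZlog.band C lo hi` of the
band `{a₀ ≤ x ≤ a₁, α x ≤ y ≤ β x}`, with the primitive `F` of the engine and the conclusion a single
`KZ.newtonLeibnizRel` instance — is TRUE on paper (all eight clauses of `KZ.newtonLeibnizRel` are met
with `n = 1`, `a = lo`, `b = hi` and the SAME `F`; see the drefute note `Negative-notes/` next to the
skeleton). Here we record, kernel-checked, which of its guards are LOAD-BEARING. Each statement below
is the registered signature verbatim with ONE clause weakened or deleted, and each is false:

* `not_subbandWithLE` — `∀ x ∈ C, lo x < hi x` weakened to `lo x ≤ hi x`: with `lo = hi ≡ 2` over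
  `C = (0,1)` the last hypothesis is void and the degenerate sub-band `C × {2}` is not inside the unit
  square, so the conclusion's `Bd.domain ⊆ r.domain` fails. Moral: STRICTNESS is not cosmetic — it is
  the only carrier of `α (x 0) ≤ lo x` and `hi x ≤ β (x 0)` (closed sub-fibre inside the closed
  fibre), which the proof needs for `Bd.domain ⊆ r.domain`, for restricting the closed-fibre
  continuity of `F`, and for reading `F` at the end points.
* `not_subbandWithoutBandGuard` — delete `α (x 0) < t ∧ t < β (x 0)` from the last hypothesis:
  the sub-band `C × [2,3]` is then admissible and again not inside the square.
* `not_subbandWithoutZGuard` — delete `Fin.snoc x t ∉ Z` from the last hypothesis: with `Z = univ`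
  the derivative hypothesis is void, and `F = y` on `[0,1]²` with integrand `0` would give
  `[(0,1) × [0,1], 0] − [(0,1), 1] ∈ newtonLeibnizRel`, i.e. `0 = 1` by soundness
  (`KZ.Equivalent.value_eq_holds`). So the sub-bands fed to this stub MUST avoid `Z` — exactly what
  the companion sub-stub `stub_bandNewtonLeibniz_cad` (two-set cylindrical decomposition adapted to
  the open band and to `Z`) supplies: over a base interval every 2-dimensional band is disjoint from
  the null set `Z`.

* (companion file `GreenBandsSubbandStrip.lean`: `not_subbandWithoutStrip` — deleting `C ⊆ {a₀ < x 0 < a₁}`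
  fails at the level of the single MOVE, by Darboux on the end-point fibre.)

Paper remarks (no Lean content): the boundedness hypothesis `∃ M, |F| ≤ M` is a convenience (the base
integrand is bounded a.e. by the fibre integral of `|r.integrand|`, FTC + Tonelli); the closed-fibre
continuity of `F` is load-bearing exactly as for the parent (`not_bandNLWithoutFibreContinuity`,
witness `𝟙{y ≥ 1}`).
-/

noncomputable section

open Set MeasureTheory MvPolynomial Filter Topology
open Literature.NumberTheory.Transcendental Literature.ModelTheory.ExponentialFields

namespace Summit.KontsevichZagierPeriods.PlanarAreas.Negative.GreenBands

/-! ## Shared test data -/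

/-- The constant function `c` on `ℝ¹` is `ℚ`-semialgebraic on the base `(0,1)` for `c ∈ ℕ`. -/
theorem isSemialgebraicFunOn_const_baseSet (c : ℕ) :
    IsSemialgebraicFunOn ℚ baseSet (fun _ : Fin 1 → ℝ => (c : ℝ)) :=
  isSemialgebraicFunOn_natCast isSemialgebraic_baseSet c

/-- The constant `0` is `ℚ`-semialgebraic on the closed unit square. -/
theorem isSemialgebraicFunOn_zero_closedSquareSet :
    IsSemialgebraicFunOn ℚ closedSquareSet (fun _ : Fin 2 → ℝ => (0 : ℝ)) := by
  simpa using isSemialgebraicFunOn_natCast isSemialgebraic_closedSquareSet 0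

/-- The base point `x₀ = (½) ∈ (0,1) ⊂ ℝ¹`. -/
def xHalf : Fin 1 → ℝ := fun _ => 1 / 2

/-- `xHalf` lies in the base `(0,1)`. -/
theorem xHalf_mem_baseSet : xHalf ∈ baseSet := by
  simp only [baseSet, xHalf, mem_setOf_eq, Rat.cast_zero, Rat.cast_one, mem_Ioo]
  norm_num

/-- A point `(x, t)` of the closed unit square has `t ≤ 1`. -/
theorem snoc_mem_closedSquareSet_le {x : Fin 1 → ℝ} {t : ℝ}
    (h : (Fin.snoc x t : Fin 2 → ℝ) ∈ closedSquareSet) : t ≤ 1 := by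
  have h' : (Fin.snoc x t : Fin 2 → ℝ) (Fin.last 1) ≤ 1 := h.2.2.2
  rwa [Fin.snoc_last] at h'

/-! ## (1) Strictness `lo < hi` is load-bearing -/

/-- `stub_bandNewtonLeibniz_subband` with `∀ x ∈ C, lo x < hi x` WEAKENED to `lo x ≤ hi x`
(everything else verbatim). -/
def SubbandWithLE : Prop := ∀ (a₀ a₁ : ℚ) (α β : ℝ → ℝ) (F : (Fin 2 → ℝ) → ℝ)
    (Z : Set (Fin 2 → ℝ)) (r : KZ.IntegralRep 2),
    r.domain = {p : Fin 2 → ℝ | p 0 ∈ Set.Icc (a₀ : ℝ) a₁ ∧ α (p 0) ≤ p 1 ∧ p 1 ≤ β (p 0)} →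
    IsSemialgebraicFunOn ℚ r.domain F → (∃ M : ℝ, ∀ p ∈ r.domain, |F p| ≤ M) →
    (∀ t ∈ Set.Ioo (a₀ : ℝ) a₁, ContinuousOn (fun s : ℝ => F ![t, s]) (Set.Icc (α t) (β t))) →
    (∀ p ∈ r.domain, p 0 ∈ Set.Ioo (a₀ : ℝ) a₁ → α (p 0) < p 1 → p 1 < β (p 0) → p ∉ Z →
      HasDerivAt (fun s : ℝ => F ![p 0, s]) (r.integrand p) (p 1)) →
    ∀ {C : Set (Fin 1 → ℝ)}, IsSemialgebraic ℚ C → C ⊆ {x | x 0 ∈ Set.Ioo (a₀ : ℝ) a₁} →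
    ∀ {lo hi : (Fin 1 → ℝ) → ℝ}, IsSemialgebraicFunOn ℚ C lo → IsSemialgebraicFunOn ℚ C hi →
    (∀ x ∈ C, lo x ≤ hi x) →
    (∀ x ∈ C, ∀ t ∈ Set.Ioo (lo x) (hi x), (α (x 0) < t ∧ t < β (x 0)) ∧
      (Fin.snoc x t : Fin 2 → ℝ) ∉ Z) →
    ∃ (Bd : KZ.IntegralRep 2) (b : KZ.IntegralRep 1), Bd.domain = KZlog.band C lo hi ∧
      Bd.domain ⊆ r.domain ∧ Bd.integrand = r.integrand ∧ b.domain = C ∧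
      (b.integrand = fun x => F (Fin.snoc x (hi x)) - F (Fin.snoc x (lo x))) ∧
      KZ.of Bd - KZ.of b ∈ KZ.newtonLeibnizRel

/-- **Strictness `lo < hi` is load-bearing in `stub_bandNewtonLeibniz_subband`.** With `lo ≤ hi`
take the unit square (`α = 0`, `β = 1`, `F = 0`, integrand `0`, `Z = ∅`), `C = (0,1)` and the
pinched sub-band `lo = hi ≡ 2`: every hypothesis holds (the guard on `Ioo (lo x) (hi x) = ∅` is
void) but `KZlog.band C 2 2 = C × {2} ⊄ [0,1]²`. -/
theorem not_subbandWithLE : ¬ SubbandWithLE := by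
  intro h
  have hbd : ∃ M : ℝ, ∀ p ∈ zeroSquare.domain, |(fun _ : Fin 2 → ℝ => (0 : ℝ)) p| ≤ M :=
    ⟨0, fun p _ => by simp⟩
  have hder : ∀ p ∈ zeroSquare.domain, p 0 ∈ Set.Ioo (((0 : ℚ)) : ℝ) ((1 : ℚ) : ℝ) →
      (fun _ : ℝ => (0 : ℝ)) (p 0) < p 1 → p 1 < (fun _ : ℝ => (1 : ℝ)) (p 0) →
      p ∉ (∅ : Set (Fin 2 → ℝ)) →
      HasDerivAt (fun s : ℝ => (fun _ : Fin 2 → ℝ => (0 : ℝ)) ![p 0, s]) (zeroSquare.integrand p) (p 1) := by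
    intro p _ _ _ _ _
    simpa using hasDerivAt_const (p 1) (0 : ℝ)
  have hlo : IsSemialgebraicFunOn ℚ baseSet (fun _ : Fin 1 → ℝ => (2 : ℝ)) := by
    simpa using isSemialgebraicFunOn_const_baseSet 2
  obtain ⟨Bd, b, hBd, hsub, -, -, -, -⟩ := h 0 1 (fun _ => 0) (fun _ => 1) (fun _ => 0) ∅ zeroSquare
    closedSquareSet_eq_band isSemialgebraicFunOn_zero_closedSquareSet hbd
    (fun t _ => continuousOn_const) hder (C := baseSet) isSemialgebraic_baseSet (fun x hx => hx)
    (lo := fun _ => 2) (hi := fun _ => 2) hlo hlo (fun x _ => le_rfl)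
    (fun x _ t ht => (lt_irrefl (2 : ℝ) (ht.1.trans ht.2)).elim)
  have hz : (Fin.snoc xHalf (2 : ℝ) : Fin 2 → ℝ) ∈ Bd.domain := by
    rw [hBd, KZlog.snoc_mem_band]
    exact ⟨xHalf_mem_baseSet, by simp⟩
  have h2 : (2 : ℝ) ≤ 1 := snoc_mem_closedSquareSet_le (hsub hz)
  norm_num at h2

/-! ## (2) The band guard `α (x 0) < t < β (x 0)` is load-bearing -/

/-- `stub_bandNewtonLeibniz_subband` with the clause `α (x 0) < t ∧ t < β (x 0)` DELETED from the
last hypothesis (everything else verbatim). -/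
def SubbandWithoutBandGuard : Prop := ∀ (a₀ a₁ : ℚ) (α β : ℝ → ℝ) (F : (Fin 2 → ℝ) → ℝ)
    (Z : Set (Fin 2 → ℝ)) (r : KZ.IntegralRep 2),
    r.domain = {p : Fin 2 → ℝ | p 0 ∈ Set.Icc (a₀ : ℝ) a₁ ∧ α (p 0) ≤ p 1 ∧ p 1 ≤ β (p 0)} →
    IsSemialgebraicFunOn ℚ r.domain F → (∃ M : ℝ, ∀ p ∈ r.domain, |F p| ≤ M) →
    (∀ t ∈ Set.Ioo (a₀ : ℝ) a₁, ContinuousOn (fun s : ℝ => F ![t, s]) (Set.Icc (α t) (β t))) →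
    (∀ p ∈ r.domain, p 0 ∈ Set.Ioo (a₀ : ℝ) a₁ → α (p 0) < p 1 → p 1 < β (p 0) → p ∉ Z →
      HasDerivAt (fun s : ℝ => F ![p 0, s]) (r.integrand p) (p 1)) →
    ∀ {C : Set (Fin 1 → ℝ)}, IsSemialgebraic ℚ C → C ⊆ {x | x 0 ∈ Set.Ioo (a₀ : ℝ) a₁} →
    ∀ {lo hi : (Fin 1 → ℝ) → ℝ}, IsSemialgebraicFunOn ℚ C lo → IsSemialgebraicFunOn ℚ C hi →
    (∀ x ∈ C, lo x < hi x) →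
    (∀ x ∈ C, ∀ t ∈ Set.Ioo (lo x) (hi x), (Fin.snoc x t : Fin 2 → ℝ) ∉ Z) →
    ∃ (Bd : KZ.IntegralRep 2) (b : KZ.IntegralRep 1), Bd.domain = KZlog.band C lo hi ∧
      Bd.domain ⊆ r.domain ∧ Bd.integrand = r.integrand ∧ b.domain = C ∧
      (b.integrand = fun x => F (Fin.snoc x (hi x)) - F (Fin.snoc x (lo x))) ∧
      KZ.of Bd - KZ.of b ∈ KZ.newtonLeibnizRel

/-- **The band guard is load-bearing in `stub_bandNewtonLeibniz_subband`.** Without it the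
sub-band `C × [2,3]` over `C = (0,1)` (outside the unit square, `Z = ∅`, `F = 0`) is admissible,
and `Bd.domain ⊆ r.domain` fails. -/
theorem not_subbandWithoutBandGuard : ¬ SubbandWithoutBandGuard := by
  intro h
  have hbd : ∃ M : ℝ, ∀ p ∈ zeroSquare.domain, |(fun _ : Fin 2 → ℝ => (0 : ℝ)) p| ≤ M :=
    ⟨0, fun p _ => by simp⟩
  have hder : ∀ p ∈ zeroSquare.domain, p 0 ∈ Set.Ioo (((0 : ℚ)) : ℝ) ((1 : ℚ) : ℝ) →
      (fun _ : ℝ => (0 : ℝ)) (p 0) < p 1 → p 1 < (fun _ : ℝ => (1 : ℝ)) (p 0) →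
      p ∉ (∅ : Set (Fin 2 → ℝ)) →
      HasDerivAt (fun s : ℝ => (fun _ : Fin 2 → ℝ => (0 : ℝ)) ![p 0, s]) (zeroSquare.integrand p) (p 1) := by
    intro p _ _ _ _ _
    simpa using hasDerivAt_const (p 1) (0 : ℝ)
  have hlo : IsSemialgebraicFunOn ℚ baseSet (fun _ : Fin 1 → ℝ => (2 : ℝ)) := by
    simpa using isSemialgebraicFunOn_const_baseSet 2
  have hhi : IsSemialgebraicFunOn ℚ baseSet (fun _ : Fin 1 → ℝ => (3 : ℝ)) := by
    simpa using isSemialgebraicFunOn_const_baseSet 3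
  obtain ⟨Bd, b, hBd, hsub, -, -, -, -⟩ := h 0 1 (fun _ => 0) (fun _ => 1) (fun _ => 0) ∅ zeroSquare
    closedSquareSet_eq_band isSemialgebraicFunOn_zero_closedSquareSet hbd
    (fun t _ => continuousOn_const) hder (C := baseSet) isSemialgebraic_baseSet (fun x hx => hx)
    (lo := fun _ => 2) (hi := fun _ => 3) hlo hhi (fun x _ => by norm_num)
    (fun x _ t _ => notMem_empty _)
  have hz : (Fin.snoc xHalf (2 : ℝ) : Fin 2 → ℝ) ∈ Bd.domain := by
    rw [hBd, KZlog.snoc_mem_band]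
    exact ⟨xHalf_mem_baseSet, by norm_num⟩
  have h2 : (2 : ℝ) ≤ 1 := snoc_mem_closedSquareSet_le (hsub hz)
  norm_num at h2

/-! ## (3) The exceptional-set guard `(x, t) ∉ Z` is load-bearing -/

/-- `stub_bandNewtonLeibniz_subband` with the clause `Fin.snoc x t ∉ Z` DELETED from the last
hypothesis (everything else verbatim). -/
def SubbandWithoutZGuard : Prop := ∀ (a₀ a₁ : ℚ) (α β : ℝ → ℝ) (F : (Fin 2 → ℝ) → ℝ)
    (Z : Set (Fin 2 → ℝ)) (r : KZ.IntegralRep 2),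
    r.domain = {p : Fin 2 → ℝ | p 0 ∈ Set.Icc (a₀ : ℝ) a₁ ∧ α (p 0) ≤ p 1 ∧ p 1 ≤ β (p 0)} →
    IsSemialgebraicFunOn ℚ r.domain F → (∃ M : ℝ, ∀ p ∈ r.domain, |F p| ≤ M) →
    (∀ t ∈ Set.Ioo (a₀ : ℝ) a₁, ContinuousOn (fun s : ℝ => F ![t, s]) (Set.Icc (α t) (β t))) →
    (∀ p ∈ r.domain, p 0 ∈ Set.Ioo (a₀ : ℝ) a₁ → α (p 0) < p 1 → p 1 < β (p 0) → p ∉ Z →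
      HasDerivAt (fun s : ℝ => F ![p 0, s]) (r.integrand p) (p 1)) →
    ∀ {C : Set (Fin 1 → ℝ)}, IsSemialgebraic ℚ C → C ⊆ {x | x 0 ∈ Set.Ioo (a₀ : ℝ) a₁} →
    ∀ {lo hi : (Fin 1 → ℝ) → ℝ}, IsSemialgebraicFunOn ℚ C lo → IsSemialgebraicFunOn ℚ C hi →
    (∀ x ∈ C, lo x < hi x) →
    (∀ x ∈ C, ∀ t ∈ Set.Ioo (lo x) (hi x), α (x 0) < t ∧ t < β (x 0)) →
    ∃ (Bd : KZ.IntegralRep 2) (b : KZ.IntegralRep 1), Bd.domain = KZlog.band C lo hi ∧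
      Bd.domain ⊆ r.domain ∧ Bd.integrand = r.integrand ∧ b.domain = C ∧
      (b.integrand = fun x => F (Fin.snoc x (hi x)) - F (Fin.snoc x (lo x))) ∧
      KZ.of Bd - KZ.of b ∈ KZ.newtonLeibnizRel

/-- **The guard `(x, t) ∉ Z` is load-bearing in `stub_bandNewtonLeibniz_subband`.** Delete it and
take `Z = univ` (derivative hypothesis void), the closed unit square with integrand `0`, the
primitive `F = y` (`|F| ≤ 1`, continuous on fibres), `C = (0,1)`, `lo = 0`, `hi = 1`: the stub would
put `[(0,1) × [0,1], 0] − [(0,1), 1]` in `newtonLeibnizRel ⊆ relations`, so `0 = 1` by soundness. -/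
theorem not_subbandWithoutZGuard : ¬ SubbandWithoutZGuard := by
  intro h
  have hbd : ∃ M : ℝ, ∀ p ∈ zeroSquare.domain, |(fun p : Fin 2 → ℝ => p 1) p| ≤ M :=
    ⟨1, fun p hp => abs_le.mpr ⟨by linarith [hp.2.2.1], hp.2.2.2⟩⟩
  have hlo : IsSemialgebraicFunOn ℚ baseSet (fun _ : Fin 1 → ℝ => (0 : ℝ)) := by
    simpa using isSemialgebraicFunOn_const_baseSet 0
  have hhi : IsSemialgebraicFunOn ℚ baseSet (fun _ : Fin 1 → ℝ => (1 : ℝ)) := by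
    simpa using isSemialgebraicFunOn_const_baseSet 1
  have hguard : ∀ x ∈ baseSet, ∀ t ∈ Set.Ioo ((fun _ : Fin 1 → ℝ => (0 : ℝ)) x)
      ((fun _ : Fin 1 → ℝ => (1 : ℝ)) x),
      (fun _ : ℝ => (0 : ℝ)) (x 0) < t ∧ t < (fun _ : ℝ => (1 : ℝ)) (x 0) :=
    fun x _ t ht => ht
  obtain ⟨Bd, b, hBd, -, hBi, hbdom, hbi, hrel⟩ := h 0 1 (fun _ => 0) (fun _ => 1) (fun p => p 1)
    univ zeroSquare closedSquareSet_eq_band isSemialgebraicFunOn_snd hbd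
    (fun t _ => continuousOn_id.congr fun s _ => by simp) (fun p _ _ _ _ hZ => (hZ (mem_univ p)).elim)
    (C := baseSet) isSemialgebraic_baseSet (fun x hx => hx) (lo := fun _ => 0) (hi := fun _ => 1)
    hlo hhi (fun x _ => zero_lt_one) hguard
  have hv : Bd.value = b.value :=
    KZ.Equivalent.value_eq_holds (KZ.newtonLeibnizRel_subset_relations hrel)
  have hBv : Bd.value = 0 := by
    simp [KZ.IntegralRep.value, hBi]
  have hbv : b.value = 1 := by
    refine value_eq_of_const hbdom 1 fun z _ => ?_
    rw [hbi]
    show (Fin.snoc z (1 : ℝ) : Fin 2 → ℝ) (Fin.last 1) - (Fin.snoc z (0 : ℝ) : Fin 2 → ℝ) (Fin.last 1) = 1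
    rw [Fin.snoc_last, Fin.snoc_last]
    norm_num
  rw [hBv, hbv] at hv
  exact zero_ne_one hv

end Summit.KontsevichZagierPeriods.PlanarAreas.Negative.GreenBands

end
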